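import Summits.MatrixMultiplication.OmegaCensus.SmallFormats.MatMul22nRankGF7Slack6FlatMain
import HarnessLib

/-!
# ω-census family (a): slack-6 certificate replay — MAIN CHECK (bucket completeness + level-1 expansion), file 6 of 114

Cell `pub-omega` (unit `pub-omega-tensor-g18`, `pub-omega-tensor-g19`), topic `Summits/MatrixMultiplication/OmegaCensus` (sub-folder `SmallFormats`).
Framing (verbatim): lottery ticket; floor = certified bounds/negative ranges. HONEST FRAMING: machine-generated kernel replay
(`pub-omega-tensor-g19/code/py/gen6_runs19.py`, from tensor g18's `gen6_runs18.py`): `LanesOK6 h 0 3692` (every lane of the total plane passes `laneOK6`) for the elements `13 ≤ h < 16` of `PGL₂(7)` (lane pieces `mainOK6K` (flat lane checker, literal plane) of ≤ 2400 level-1 loop nodes, 3660 in this file, glued by `lanesOK6_of_piece` / `lanesOK6_append`). Soundness is in `MatMul22nRankGF7Slack6SearchSound` /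
`MatMul22nRankGF7Slack6SearchFinal`; nothing here is progress on `ω`.
-/

namespace Summit.MatrixMultiplication.OmegaCensus.SmallFormats

set_option Elab.async false

set_option maxRecDepth 100000 in
set_option maxHeartbeats 400000000 in
/-- Element `13`: lanes `0 ≤ c < 3692` of the total plane pass (850 level-1 loop search nodes). -/
theorem mainOK6K_13_0 : mainOK6K 13 0 3692 = true := by decide +kernel

/-- **All 3 692 lanes of element `13` pass** (1 pieces; 850 loop search nodes). -/
theorem lanesOK6_h13 : LanesOK6 13 0 3692 := (lanesOK6_of_pieceK mainOK6K_13_0)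

set_option maxRecDepth 100000 in
set_option maxHeartbeats 400000000 in
/-- Element `14`: lanes `0 ≤ c < 3692` of the total plane pass (1122 level-1 loop search nodes). -/
theorem mainOK6K_14_0 : mainOK6K 14 0 3692 = true := by decide +kernel

/-- **All 3 692 lanes of element `14` pass** (1 pieces; 1122 loop search nodes). -/
theorem lanesOK6_h14 : LanesOK6 14 0 3692 := (lanesOK6_of_pieceK mainOK6K_14_0)

set_option maxRecDepth 100000 in
set_option maxHeartbeats 400000000 in
/-- Element `15`: lanes `0 ≤ c < 3692` of the total plane pass (1688 level-1 loop search nodes). -/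
theorem mainOK6K_15_0 : mainOK6K 15 0 3692 = true := by decide +kernel

/-- **All 3 692 lanes of element `15` pass** (1 pieces; 1688 loop search nodes). -/
theorem lanesOK6_h15 : LanesOK6 15 0 3692 := (lanesOK6_of_pieceK mainOK6K_15_0)

/-- **MAIN CHECK lanes for `13 ≤ · < 16`** (this file). -/
theorem lanesOK6_runM_6 : ∀ x, 13 ≤ x → x < 16 → LanesOK6 x 0 3692 := by
  intro x _h1 h2
  by_cases g14 : x < 14
  · have e : x = 13 := by omega
    subst e; exact lanesOK6_h13
  by_cases g15 : x < 15
  · have e : x = 14 := by omega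
    subst e; exact lanesOK6_h14
  have e : x = 15 := by omega
  subst e; exact lanesOK6_h15

end Summit.MatrixMultiplication.OmegaCensus.SmallFormats
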